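import Summits.Parity.GeneralizedHardyLittlewood.Theorems.DicksonFibrationDimOnePerimeter
import Summits.Parity.GeneralizedHardyLittlewood.Theses.TwinMinorArcs
import HarnessLib

/-!
# The open core of `BoundedDickson` (stub `stub_boundedDickson` of crux `TwinLowerDensityToGHL`, stmt-Parity-18380)

The registered stub `stub_boundedDickson` of `Cruxes/TwinLowerDensityToGHL/Lines/birth_ParityLeakOneFifth.lean` is
VERBATIM the hub node `BoundedDickson` (stmt-Parity-13151): Dickson–Hardy–Littlewood for every FIXED non-degenerate
one-dimensional system `Φ : Fin t → AffLinForm 1`, `t ≥ 1`.  Two families of its instances are theorems IN THE TREE,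
in the stronger shift-uniform form of crux `DimOne` (`Theorems/DicksonFibrationDimOnePerimeter.lean`, lead c3 of
stmt-Parity-0819): the `t = 1` slice (`dimOne_one`, the prime number theorem in progressions) and the LOCALLY
OBSTRUCTED systems (`dimOne_of_localFactor_eq_zero`: `β_p(Φ) = 0` at some prime, e.g. `(n, n + 1)`, `(n, n + 2, n + 4)`).
Specialising them to a fixed system (`L := ⌈‖Φ‖₁⌉`, `‖Φ‖_N ≤ ‖Φ‖₁` for `N ≥ 1`) peels the provable perimeter off the
stub:

* `boundedDickson_of_core` — `BoundedDickson` follows from its restriction to `t ≥ 2` and systems with `β_p(Φ) > 0` at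
  every prime (no local obstruction, `⟺ 𝔖(Φ) > 0`);
* `core_of_boundedDickson` — the converse (restriction);
* `boundedDickson_iff_core` — so the stub IS, exactly, the ADMISSIBLE fixed-pattern prime `t`-tuple asymptotic with
  von Mangoldt weights, `t ≥ 2` (twins `(n, n+2)`, Sophie Germain `(n, 2n+1)`, prime `k`-tuples in progressions) — the
  classical open problem (Literature.Barriers.Parity.SelbergParityBarrier / PrimePairParity bite here and only here).

No new definitions; the core is written out inline. [cite: GreenTao2010, Conj. 1.2 (d = 1), Lemma 1.3 and the sentence
following it] [cite: Dickson1904]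
-/

open Finset

namespace Summit.Parity.GeneralizedHardyLittlewood.TwinLowerDensityToGHLBoundedDicksonCore

open Literature.NumberTheory.Sieve
open Summit.Parity.GeneralizedHardyLittlewood.Cruxes.DimOne.BirthSieve (dimOne_one dimOne_of_localFactor_eq_zero)
open Summit.Parity.GeneralizedHardyLittlewood.Theses.TwinMinorArcs (BoundedDickson)

/-- A fixed system has bounded size at every scale `N ≥ 1`: `‖Φ‖_N ≤ ⌈‖Φ‖₁⌉`. [cite: GreenTao2010, (1.1)] -/
theorem affLinSize_le_ceil_one {t : ℕ} (Φ : Fin t → AffLinForm 1) {N : ℕ} (hN : 1 ≤ N) :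
    affLinSize Φ N ≤ (⌈affLinSize Φ 1⌉₊ : ℕ) := by
  have hN1 : (1 : ℝ) ≤ N := by exact_mod_cast hN
  have hmono : affLinSize Φ N ≤ affLinSize Φ 1 := by
    unfold affLinSize
    refine add_le_add le_rfl (Finset.sum_le_sum fun i _ => ?_)
    rw [abs_div, abs_div, abs_one, div_one, abs_of_pos (by linarith : (0 : ℝ) < N)]
    exact div_le_self (abs_nonneg _) hN1
  exact hmono.trans (Nat.le_ceil _)

/-- **Restriction**: `BoundedDickson` implies its admissible core (`t ≥ 2`, `β_p(Φ) > 0` at every prime).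
[cite: GreenTao2010, Conj. 1.2 (d = 1)] -/
theorem core_of_boundedDickson (h : BoundedDickson) :
    ∀ (t : ℕ), 2 ≤ t → ∀ Φ : Fin t → AffLinForm 1, IsNondegenerateSystem Φ →
      (∀ p : ℕ, p.Prime → 0 < localFactor Φ p) →
      ∀ ε : ℝ, 0 < ε → ∃ N₀ : ℕ, ∀ N : ℕ, N₀ ≤ N → ∀ K : Set (Fin 1 → ℝ), Convex ℝ K → K ⊆ realBox 1 N →
        |vonMangoldtSum Φ K N - archFactor Φ K * singularProduct Φ| ≤ ε * N :=
  fun t ht Φ hΦ _ ε hε => h t Φ (by omega) hΦ ε hε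

/-- **`BoundedDickson` from its admissible core.**  If Dickson–Hardy–Littlewood holds for every fixed
non-degenerate system of `t ≥ 2` forms WITHOUT local obstruction (`β_p(Φ) > 0` at every prime), then it holds
for every fixed non-degenerate system: the `t = 1` slice is the tree's unconditional `dimOne_one` (PNT in
progressions, even shift-uniform) and a locally obstructed system is the tree's unconditional
`dimOne_of_localFactor_eq_zero` (`𝔖 = 0`, sum `O(log^{t+1} N)`), both specialised to `L := ⌈‖Φ‖₁⌉`.
[cite: GreenTao2010, Conj. 1.2 (d = 1), Lemma 1.3] -/
theorem boundedDickson_of_core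
    (hcore : ∀ (t : ℕ), 2 ≤ t → ∀ Φ : Fin t → AffLinForm 1, IsNondegenerateSystem Φ →
      (∀ p : ℕ, p.Prime → 0 < localFactor Φ p) →
      ∀ ε : ℝ, 0 < ε → ∃ N₀ : ℕ, ∀ N : ℕ, N₀ ≤ N → ∀ K : Set (Fin 1 → ℝ), Convex ℝ K → K ⊆ realBox 1 N →
        |vonMangoldtSum Φ K N - archFactor Φ K * singularProduct Φ| ≤ ε * N) :
    BoundedDickson := by
  intro t Φ ht hΦ ε hε
  set L : ℕ := ⌈affLinSize Φ 1⌉₊ with hL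
  rcases Nat.lt_or_ge t 2 with ht2 | ht2
  · -- one form: the prime number theorem in progressions (tree, unconditional, shift-uniform)
    obtain rfl : t = 1 := by omega
    obtain ⟨N₀, hN₀⟩ := dimOne_one L ε hε
    exact ⟨max 1 N₀, fun N hN K hK hKN =>
      hN₀ N (le_of_max_le_right hN) Φ hΦ (affLinSize_le_ceil_one Φ (le_of_max_le_left hN)) K hK hKN⟩
  · by_cases hob : ∃ p : ℕ, p.Prime ∧ localFactor Φ p = 0
    · -- locally obstructed: `𝔖(Φ) = 0` and the prime sum is `O(log^{t+1} N)` (tree, unconditional)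
      obtain ⟨p, hp, h0⟩ := hob
      obtain ⟨N₀, hN₀⟩ := dimOne_of_localFactor_eq_zero t L ε hε
      exact ⟨max 1 N₀, fun N hN K _ _ =>
        hN₀ N (le_of_max_le_right hN) Φ hΦ (affLinSize_le_ceil_one Φ (le_of_max_le_left hN)) p hp h0 K⟩
    · -- admissible, `t ≥ 2`: the open core
      push Not at hob
      have hpos : ∀ p : ℕ, p.Prime → 0 < localFactor Φ p := fun p hp =>
        lt_of_le_of_ne (localFactor_nonneg Φ p) (fun h => hob p hp h.symm)
      exact hcore t ht2 Φ hΦ hpos ε hε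

/-- **The stub IS its admissible core.**  `BoundedDickson` (stmt-Parity-13151 = `stub_boundedDickson` of
stmt-Parity-18380, verbatim) is EQUIVALENT to the admissible fixed-pattern prime `t`-tuple asymptotic for `t ≥ 2`
(von Mangoldt weights, every convex `K ⊆ [−N, N]`, no local obstruction). [cite: GreenTao2010, Conj. 1.2 (d = 1)] -/
theorem boundedDickson_iff_core :
    BoundedDickson ↔
      ∀ (t : ℕ), 2 ≤ t → ∀ Φ : Fin t → AffLinForm 1, IsNondegenerateSystem Φ →
        (∀ p : ℕ, p.Prime → 0 < localFactor Φ p) →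
        ∀ ε : ℝ, 0 < ε → ∃ N₀ : ℕ, ∀ N : ℕ, N₀ ≤ N → ∀ K : Set (Fin 1 → ℝ), Convex ℝ K → K ⊆ realBox 1 N →
          |vonMangoldtSum Φ K N - archFactor Φ K * singularProduct Φ| ≤ ε * N :=
  ⟨core_of_boundedDickson, boundedDickson_of_core⟩

/-- Kernel check: `BoundedDickson` is the REGISTERED text of `stub_boundedDickson` verbatim. -/
example :
    BoundedDickson ↔
      ∀ (t : ℕ) (Φ : Fin t → Literature.NumberTheory.Sieve.AffLinForm 1), 1 ≤ t → Literature.NumberTheory.Sieve.IsNondegenerateSystem Φ → ∀ ε : ℝ, 0 < ε → ∃ N₀ : ℕ, ∀ N : ℕ, N₀ ≤ N → ∀ K : Set (Fin 1 → ℝ), Convex ℝ K → K ⊆ Literature.NumberTheory.Sieve.realBox 1 N → |Literature.NumberTheory.Sieve.vonMangoldtSum Φ K N - Literature.NumberTheory.Sieve.archFactor Φ K * Literature.NumberTheory.Sieve.singularProduct Φ| ≤ ε * N :=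
  Iff.rfl

end Summit.Parity.GeneralizedHardyLittlewood.TwinLowerDensityToGHLBoundedDicksonCore
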